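import Literature.MathematicalPhysics.QuantumLattice.FermiRG.BGM2003SectorPropagatorDecayFrame
import HarnessLib

/-!
# Benfatto–Giuliani–Mastropietro 2003, Lemma 2.1 [lm3.1] (3.22) — proof, part 2: the weighted sector symbol
# as the value of ONE smooth master function; `h`-uniform symbol bounds by compactness

Topic `Literature/MathematicalPhysics/QuantumLattice/FermiRG`; continues `BGM2003SectorPropagatorDecayFrame.lean`
(seat t3; discharge of F3c's named fact `BGM2003.lemma21_sectorPropagatorDecay`, concluded in
`BGM2003SectorPropagatorDecayProof.lean`).  Source: G. Benfatto, A. Giuliani, V. Mastropietro, Ann. Henri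
Poincaré 4 (2003) 137–193, arXiv:cond-mat/0207210 [BenfattoGiulianiMastropietro2003], §2.3 (3.20)–(3.22) p.8 and
§7.2 p.27 (L28–52) of the materialised TeX; the architecture is the tree's `SectorSymbolMaster{,Smooth,Box}` (BGM
2006 Lemma 2.2 for the Hubbard band), here for a general `DispersionHyp` datum and with the polynomial weights
that the derivatives `∂_{x₀}^{n₀}∂_{x'₁}^{n₁}∂_{x'₂}^{n₂}` of (3.22) bring down.

* `BGM2003.wSymbol … n σ n₀ n₁ n₂ (k₀, k⃗)` — the integrand of (3.20) without the oscillating exponential,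
  `F_{h,σ}(k)/(−ik₀ + ε(k⃗) − μ)` (F3c's `sectorCutoff`, INCLUDING its indicator of the shell `ℬ`), multiplied by
  the weight `(−ik₀)^{n₀}(−ik'₁)^{n₁}(−ik'₂)^{n₂}`, `k'₁ = (k⃗ − p⃗_F(θ_{h,σ}))·n⃗`, `k'₂ = (k⃗ − p⃗_F(θ_{h,σ}))·τ⃗`
  ((3.21a); `frameCoord₁/₂`);
* `BGM2003.master … r χ n₀ n₁ n₂ (θ₀,a,b) t₀ s` — the **master function**
  `(−it₀)^{n₀}(−ia)^{n₁}(−ib)^{n₂} · G(√(t₀²+Ẽ²)) · ψ(u) · W(Ã/π) · χ(k⃗) · conj(D̃) η(|D̃|²)`, `G = gnShell 4 e₀ 0`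
  the `h`-free shell profile, `Ẽ`, `Ã`, `u`, `k⃗ = chartPt` from part 1, `ψ = truncOne`, `W = sectorUnitWeight`, `χ`
  a smooth shell bump (part 1, `DispersionHyp.exists_shellBump`), `D̃ = −it₀ + Ẽ` (`rDenom`),
  `η = sectorInvCutoff (e₀/16)²`; jointly SMOOTH in `((θ₀,s), t)` (`DispersionHyp.contDiff_masterL`);
* **the central identity** `DispersionHyp.rescaledWSymbol_eq_master`: at `s = 2^{-n} = γ^{h/2}`,
  `θ₀ = θ_{h,σ}`, the weighted symbol in chart coordinates `t = (t₀,a,b)` (`k₀ = 4^{-n}t₀`,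
  `k⃗ = p⃗_F + 4^{-n}a n⃗ + 2^{-n}b τ⃗`) equals `4ⁿ·4^{-n n₀}·4^{-n n₁}·2^{-n n₂} · master(…)` (`scaleFactor`) — the
  factor `γ^{-h}` of the propagator and the factors `γ^{h n₀} γ^{h n₁} γ^{h n₂/2}` of (3.22);
* **the box** `DispersionHyp.exists_box_rescaledWSymbol`: the rescaled symbol is supported in
  `{|t₀| ≤ e₀, |a| ≤ c, |b| ≤ c}` for ALL `h ≤ 0`, `σ ∈ O_h` — this is F3b's PROVED sector Lemma 7.3
  `lemma73_sectorBox_holds` (|k'₁| ≤ cγ^h, |k'₂| ≤ cγ^{h/2});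
* **`h`-uniform `C^m` bounds** `DispersionHyp.exists_norm_iteratedFDeriv_rescaledWSymbol_le`: for every `m`
  there is `B` with `‖D^m(rescaled symbol)‖ ≤ scaleFactor · B` uniformly in `h ≤ 0`, `σ ∈ O_h`, `t` (continuity of
  `D^m master` on the compact `[0,2π] × [0,1] × box`, the tree's `norm_iteratedFDeriv_slice_le`).

Everything here is PROVED; no named fact is introduced (D-0026).
-/

noncomputable section

open Real Set Complex Function Filter
open scoped Topology ContDiff ComplexConjugate
open Literature.Analysis.Calculus Literature.Analysis.SpecialFunctions

namespace Literature.MathematicalPhysics.QuantumLattice.FermiRG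

namespace BGM2003

variable {ε : (Fin 2 → ℝ) → ℝ} {μ e₀ : ℝ} {u : ℝ → ℝ → ℝ}

/-! ### Scale covariance of the shell profile -/

/-- **`f_h(r) = f_0(γ^{-h} r)`** for the tree's profile `gnShell` (`γ = 4`, `h = -n`): the single-scale cutoff at
scale `h` is the scale-zero profile of the rescaled argument ((3.4): `f̃_h(t) = H₀(γ^{-h}t) − H₀(γ^{-h+1}t)`).
[cite: BenfattoGiulianiMastropietro2003, §2.1 (3.4) p.6 (L86–92)] -/
theorem gnShell_neg_natCast (e₀ r : ℝ) (n : ℕ) :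
    gnShell 4 e₀ (-(n : ℤ)) r = gnShell 4 e₀ 0 ((4 : ℝ) ^ n * r) := by
  simp only [gnShell, gnScaleCutoff, neg_neg, zpow_natCast, neg_zero, zpow_zero, one_mul, zero_sub]
  congr 2
  rw [show -(-(n : ℤ) - 1) = (n : ℤ) + 1 by ring, zpow_add_one₀ (by norm_num : (4 : ℝ) ≠ 0), zpow_natCast]
  simp only [zpow_one]
  ring

/-! ### The frame coordinates and the weighted symbol -/

/-- `k'₁ = (k⃗ − p⃗_F(θ₀))·n⃗(θ₀)`, the normal frame coordinate of (3.21a). [cite: BenfattoGiulianiMastropietro2003, §2.3 (3.21a) p.8 (L36–41)] -/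
def frameCoord₁ (u : ℝ → ℝ → ℝ) (θ₀ : ℝ) (k : Fin 2 → ℝ) : ℝ :=
  ∑ i : Fin 2, (k i - fermiPoint u θ₀ i) * unitNormal u θ₀ 0 i

/-- `k'₂ = (k⃗ − p⃗_F(θ₀))·τ⃗(θ₀)`, the tangential frame coordinate of (3.21a). [cite: BenfattoGiulianiMastropietro2003, §2.3 (3.21a) p.8 (L36–41)] -/
def frameCoord₂ (u : ℝ → ℝ → ℝ) (θ₀ : ℝ) (k : Fin 2 → ℝ) : ℝ :=
  ∑ i : Fin 2, (k i - fermiPoint u θ₀ i) * unitTangent u θ₀ 0 i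

/-- `k'₁` of the chart point is `s²a`. [cite: BenfattoGiulianiMastropietro2003, §2.3 (3.21a) p.8 (L36–41)] -/
theorem DispersionHyp.frameCoord₁_chartPt (hD : DispersionHyp ε μ e₀ u) (θ₀ a b s : ℝ) :
    frameCoord₁ u θ₀ (chartPt u (θ₀, a, b) s) = s ^ 2 * a :=
  hD.chartPt_sub_dot_unitNormal (θ₀, a, b) s

/-- `k'₂` of the chart point is `sb`. [cite: BenfattoGiulianiMastropietro2003, §2.3 (3.21a) p.8 (L36–41)] -/
theorem DispersionHyp.frameCoord₂_chartPt (hD : DispersionHyp ε μ e₀ u) (θ₀ a b s : ℝ) :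
    frameCoord₂ u θ₀ (chartPt u (θ₀, a, b) s) = s * b :=
  hD.chartPt_sub_dot_unitTangent (θ₀, a, b) s

/-- Frame coordinates are the unique coefficients: if `k⃗ = p⃗_F + k₁n⃗ + k₂τ⃗` then `k'₁ = k₁`, `k'₂ = k₂`.
[cite: BenfattoGiulianiMastropietro2003, §2.3 (3.21a) p.8 (L36–41)] -/
theorem DispersionHyp.frameCoord_of_eq (hD : DispersionHyp ε μ e₀ u) (θ₀ k₁ k₂ : ℝ) {k : Fin 2 → ℝ}
    (hk : k = fermiPoint u θ₀ + k₁ • unitNormal u θ₀ 0 + k₂ • unitTangent u θ₀ 0) :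
    frameCoord₁ u θ₀ k = k₁ ∧ frameCoord₂ u θ₀ k = k₂ := by
  have he : |(0 : ℝ)| ≤ e₀ := by rw [abs_zero]; exact hD.e₀_pos.le
  have hn := hD.unitNormal_normSq θ₀ he
  have hτ := hD.unitTangent_normSq θ₀ he
  have ht := unitNormal_dot_unitTangent u θ₀ 0
  subst hk
  simp only [frameCoord₁, frameCoord₂, Fin.sum_univ_two, Pi.add_apply, Pi.smul_apply, smul_eq_mul]
  constructor
  · linear_combination k₁ * hn + k₂ * ht
  · linear_combination k₂ * hτ + k₁ * ht

/-- **The weighted sector symbol** `S_α(k) = (−ik₀)^{n₀}(−ik'₁)^{n₁}(−ik'₂)^{n₂} · F_{h,σ}(k)/(−ik₀ + ε(k⃗) − μ)` of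
scale `h = −n`, sector `σ` (`θ₀ = θ_{h,σ} = sectorCenter n σ`), with F3c's `sectorCutoff` as `F_{h,σ}` read on `ℬ`:
the integrand of (3.20)/(3.20c) stripped of `e^{-i(k₀x₀ + k⃗'x⃗)}(2π)^{-3}`, times the polynomial that
`∂_{x₀}^{n₀}∂_{x'₁}^{n₁}∂_{x'₂}^{n₂}` brings down. [cite: BenfattoGiulianiMastropietro2003, §2.3 (3.20c)–(3.22) p.8 (L43–63)] -/
def wSymbol (ε : (Fin 2 → ℝ) → ℝ) (μ e₀ : ℝ) (u : ℝ → ℝ → ℝ) (n σ n₀ n₁ n₂ : ℕ) (p : ℝ × (Fin 2 → ℝ)) : ℂ :=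
  (-(I * (p.1 : ℂ))) ^ n₀ * (-(I * (frameCoord₁ u (sectorCenter n σ) p.2 : ℂ))) ^ n₁ *
      (-(I * (frameCoord₂ u (sectorCenter n σ) p.2 : ℂ))) ^ n₂ *
    (((sectorCutoff ε μ e₀ u n σ p : ℝ) : ℂ) / (-(I * (p.1 : ℂ)) + ((ε p.2 - μ : ℝ) : ℂ)))

/-- **The weighted symbol in chart coordinates** `t = (t₀, a, b)`: `k₀ = 4^{-n}t₀`,
`k⃗ = p⃗_F(θ_{h,σ}) + 4^{-n}a n⃗ + 2^{-n}b τ⃗` (`= chartPt (θ_{h,σ},a,b) 2^{-n}`). [cite: BenfattoGiulianiMastropietro2003, §2.3 (3.21a) p.8 (L36–41) and §7.2 p.27 (L28–52)] -/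
def rescaledWSymbol (ε : (Fin 2 → ℝ) → ℝ) (μ e₀ : ℝ) (u : ℝ → ℝ → ℝ) (n σ n₀ n₁ n₂ : ℕ) : MomSpace → ℂ :=
  fun t => wSymbol ε μ e₀ u n σ n₀ n₁ n₂
    ((4 : ℝ) ^ (-(n : ℤ)) * t 0, chartPt u (sectorCenter n σ, t 1, t 2) ((2 : ℝ) ^ (-(n : ℤ))))

/-- **The scale factor** `γ^{-h} · γ^{h n₀} γ^{h n₁} γ^{h n₂/2} = 4ⁿ (4^{-n})^{n₀} (4^{-n})^{n₁} (2^{-n})^{n₂}` of the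
central identity (the `γ^{-h}` of `1/(−ik₀ + ε − μ)` and the weights of (3.22)). [cite: BenfattoGiulianiMastropietro2003, §2.3 Lemma 2.1 (3.22) p.8 (L57–63)] -/
def scaleFactor (n n₀ n₁ n₂ : ℕ) : ℝ :=
  (4 : ℝ) ^ n * ((4 : ℝ) ^ (-(n : ℤ))) ^ n₀ * ((4 : ℝ) ^ (-(n : ℤ))) ^ n₁ * ((2 : ℝ) ^ (-(n : ℤ))) ^ n₂

/-- `0 < scaleFactor`. [cite: BenfattoGiulianiMastropietro2003, §2.3 Lemma 2.1 (3.22) p.8 (L57–63)] -/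
theorem scaleFactor_pos (n n₀ n₁ n₂ : ℕ) : 0 < scaleFactor n n₀ n₁ n₂ := by
  unfold scaleFactor; positivity

/-! ### The master function -/

/-- The rescaled denominator `D̃ = −it₀ + Ẽ` (`−ik₀ + ε − μ = 4^{-n} D̃`). [cite: BenfattoGiulianiMastropietro2003, §7.2 p.27 (L28–52)] -/
def rDenom (ε : (Fin 2 → ℝ) → ℝ) (u : ℝ → ℝ → ℝ) (μ : ℝ) (x : ℝ × ℝ × ℝ) (t₀ s : ℝ) : ℂ :=
  -(I * (t₀ : ℂ)) + (rescaledEps ε u μ (x, s) : ℂ)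

/-- `|D̃|² = t₀² + Ẽ²`. [cite: BenfattoGiulianiMastropietro2003, §7.2 p.27 (L28–52)] -/
theorem normSq_rDenom (ε : (Fin 2 → ℝ) → ℝ) (u : ℝ → ℝ → ℝ) (μ : ℝ) (x : ℝ × ℝ × ℝ) (t₀ s : ℝ) :
    Complex.normSq (rDenom ε u μ x t₀ s) = t₀ ^ 2 + rescaledEps ε u μ (x, s) ^ 2 := by
  rw [rDenom, Complex.normSq_apply]
  simp
  ring

/-- **The master function** `Ψ_α(θ₀,a,b; t₀; s) = (−it₀)^{n₀}(−ia)^{n₁}(−ib)^{n₂} G(√(t₀²+Ẽ²)) ψ(u) W(Ã/π) χ(k⃗) conj(D̃) η(|D̃|²)`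
(see the module docstring), with the truncation radius `r` and the shell bump `χ` as parameters.
[cite: BenfattoGiulianiMastropietro2003, §7.2 p.27 (L28–52)] -/
def master (ε : (Fin 2 → ℝ) → ℝ) (u : ℝ → ℝ → ℝ) (μ e₀ r : ℝ) (χ : (Fin 2 → ℝ) → ℝ) (n₀ n₁ n₂ : ℕ)
    (x : ℝ × ℝ × ℝ) (t₀ s : ℝ) : ℂ :=
  ((-(I * (t₀ : ℂ))) ^ n₀ * (-(I * (x.2.1 : ℂ))) ^ n₁ * (-(I * (x.2.2 : ℂ))) ^ n₂) *
    (((gnShell 4 e₀ 0 (Real.sqrt (t₀ ^ 2 + rescaledEps ε u μ (x, s) ^ 2)) *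
          truncOne (2 * r) (Real.cos (3 * π / 4)) (Real.cos (7 * π / 8)) (uFun u x s) *
          sectorUnitWeight (rescaledAng u r (x, s) / π) * χ (chartPt u x s) : ℝ) : ℂ) *
      (conj (rDenom ε u μ x t₀ s) * (sectorInvCutoff ((e₀ / 16) ^ 2) (Complex.normSq (rDenom ε u μ x t₀ s)) : ℂ)))

/-- The master function as a function of `((θ₀, s), t) ∈ ℝ² × ℝ³` (the shape of the tree's `masterLift`).
[cite: BenfattoGiulianiMastropietro2003, §7.2 p.27 (L28–52)] -/
def masterL (ε : (Fin 2 → ℝ) → ℝ) (u : ℝ → ℝ → ℝ) (μ e₀ r : ℝ) (χ : (Fin 2 → ℝ) → ℝ) (n₀ n₁ n₂ : ℕ)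
    (q : (ℝ × ℝ) × MomSpace) : ℂ :=
  master ε u μ e₀ r χ n₀ n₁ n₂ (q.1.1, q.2 1, q.2 2) (q.2 0) q.1.2

/-- **The master function is jointly smooth** (for `r > 0` and a smooth `χ`). [cite: BenfattoGiulianiMastropietro2003, §7.2 p.27 (L28–52)] -/
theorem DispersionHyp.contDiff_masterL (hD : DispersionHyp ε μ e₀ u) {r : ℝ} (hr : 0 < r) {χ : (Fin 2 → ℝ) → ℝ}
    (hχ : ContDiff ℝ ∞ χ) (n₀ n₁ n₂ : ℕ) : ContDiff ℝ ∞ (masterL ε u μ e₀ r χ n₀ n₁ n₂) := by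
  have he := hD.e₀_pos
  have hθ : ContDiff ℝ ∞ fun q : (ℝ × ℝ) × MomSpace => q.1.1 := contDiff_fst.comp contDiff_fst
  have hs : ContDiff ℝ ∞ fun q : (ℝ × ℝ) × MomSpace => q.1.2 := contDiff_snd.comp contDiff_fst
  have h0 := contDiff_momSpace_coord 0 (n := ∞)
  have h1 := contDiff_momSpace_coord 1 (n := ∞)
  have h2 := contDiff_momSpace_coord 2 (n := ∞)
  have hx : ContDiff ℝ ∞ fun q : (ℝ × ℝ) × MomSpace => ((q.1.1, q.2 1, q.2 2) : ℝ × ℝ × ℝ) :=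
    hθ.prodMk (h1.prodMk h2)
  have hxs : ContDiff ℝ ∞ fun q : (ℝ × ℝ) × MomSpace => (((q.1.1, q.2 1, q.2 2), q.1.2) : (ℝ × ℝ × ℝ) × ℝ) :=
    hx.prodMk hs
  -- the monomial weight
  have hI0 : ContDiff ℝ ∞ fun q : (ℝ × ℝ) × MomSpace => (-(I * ((q.2 0 : ℝ) : ℂ))) ^ n₀ :=
    (contDiff_const.mul (Complex.ofRealCLM.contDiff.comp h0)).neg.pow _
  have hI1 : ContDiff ℝ ∞ fun q : (ℝ × ℝ) × MomSpace => (-(I * ((q.2 1 : ℝ) : ℂ))) ^ n₁ :=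
    (contDiff_const.mul (Complex.ofRealCLM.contDiff.comp h1)).neg.pow _
  have hI2 : ContDiff ℝ ∞ fun q : (ℝ × ℝ) × MomSpace => (-(I * ((q.2 2 : ℝ) : ℂ))) ^ n₂ :=
    (contDiff_const.mul (Complex.ofRealCLM.contDiff.comp h2)).neg.pow _
  -- the rescaled dispersion and denominator
  have hE : ContDiff ℝ ∞ fun q : (ℝ × ℝ) × MomSpace => rescaledEps ε u μ ((q.1.1, q.2 1, q.2 2), q.1.2) :=
    hD.contDiff_rescaledEps.comp hxs
  have hDn : ContDiff ℝ ∞ fun q : (ℝ × ℝ) × MomSpace => rDenom ε u μ (q.1.1, q.2 1, q.2 2) (q.2 0) q.1.2 := by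
    unfold rDenom
    exact (contDiff_const.mul (Complex.ofRealCLM.contDiff.comp h0)).neg.add (Complex.ofRealCLM.contDiff.comp hE)
  -- the shell factor
  have hG : ContDiff ℝ ∞ fun q : (ℝ × ℝ) × MomSpace =>
      gnShell 4 e₀ 0 (Real.sqrt (q.2 0 ^ 2 + rescaledEps ε u μ ((q.1.1, q.2 1, q.2 2), q.1.2) ^ 2)) := by
    have hsq : ContDiff ℝ ∞ fun ρ : ℝ => gnShell 4 e₀ 0 (Real.sqrt ρ) :=
      contDiff_comp_sqrt_of_eq_zero (contDiff_gnShell 4 e₀ 0) (a := e₀ * (4 : ℝ) ^ ((0 : ℤ) - 2))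
        (mul_pos he (zpow_pos (by norm_num) _)) fun t ht => gnShell_eq_zero_of_le (by norm_num) he ht
    exact hsq.comp ((h0.pow 2).add (hE.pow 2))
  -- the angular factors and the shell bump
  have hu : ContDiff ℝ ∞ fun q : (ℝ × ℝ) × MomSpace => uncurry (uFun u) ((q.1.1, q.2 1, q.2 2), q.1.2) :=
    hD.contDiff_uncurry_uFun.comp hxs
  simp only [uncurry_apply_pair] at hu
  have hk : ContDiff ℝ ∞ fun q : (ℝ × ℝ) × MomSpace => uncurry (chartPt u) ((q.1.1, q.2 1, q.2 2), q.1.2) :=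
    hD.contDiff_uncurry_chartPt.comp hxs
  simp only [uncurry_apply_pair] at hk
  have h2r : 0 < 2 * r := by positivity
  have hψ : ContDiff ℝ ∞ fun q : (ℝ × ℝ) × MomSpace =>
      truncOne (2 * r) (Real.cos (3 * π / 4)) (Real.cos (7 * π / 8)) (uFun u (q.1.1, q.2 1, q.2 2) q.1.2) :=
    (contDiff_truncOne (c₁ := Real.cos (3 * π / 4)) (c₂ := Real.cos (7 * π / 8)) h2r).comp hu
  have hW : ContDiff ℝ ∞ fun q : (ℝ × ℝ) × MomSpace => sectorUnitWeight (rescaledAng u r ((q.1.1, q.2 1, q.2 2), q.1.2) / π) :=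
    contDiff_sectorUnitWeight.comp (((hD.contDiff_rescaledAng hr).comp hxs).div_const _)
  have hχ' : ContDiff ℝ ∞ fun q : (ℝ × ℝ) × MomSpace => χ (chartPt u (q.1.1, q.2 1, q.2 2) q.1.2) := hχ.comp hk
  -- the inverse factor
  have hnSq : ContDiff ℝ ∞ fun q : (ℝ × ℝ) × MomSpace =>
      Complex.normSq (rDenom ε u μ (q.1.1, q.2 1, q.2 2) (q.2 0) q.1.2) := by
    have hfun : (fun q : (ℝ × ℝ) × MomSpace => Complex.normSq (rDenom ε u μ (q.1.1, q.2 1, q.2 2) (q.2 0) q.1.2)) =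
        fun q => ‖rDenom ε u μ (q.1.1, q.2 1, q.2 2) (q.2 0) q.1.2‖ ^ 2 := by
      funext q; exact Complex.normSq_eq_norm_sq _
    rw [hfun]
    exact hDn.norm_sq ℝ
  have hη : ContDiff ℝ ∞ fun q : (ℝ × ℝ) × MomSpace =>
      sectorInvCutoff ((e₀ / 16) ^ 2) (Complex.normSq (rDenom ε u μ (q.1.1, q.2 1, q.2 2) (q.2 0) q.1.2)) :=
    (contDiff_sectorInvCutoff (q₀ := (e₀ / 16) ^ 2) (by positivity)).comp hnSq
  have hconj : ContDiff ℝ ∞ fun q : (ℝ × ℝ) × MomSpace => conj (rDenom ε u μ (q.1.1, q.2 1, q.2 2) (q.2 0) q.1.2) :=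
    Complex.conjCLE.contDiff.comp hDn
  have hmono := (hI0.mul hI1).mul hI2
  have hreal := ((hG.mul hψ).mul hW).mul hχ'
  have hcplx := hconj.mul (Complex.ofRealCLM.contDiff.comp hη)
  have hfin := hmono.mul ((Complex.ofRealCLM.contDiff.comp hreal).mul hcplx)
  have key : masterL ε u μ e₀ r χ n₀ n₁ n₂ = fun q : (ℝ × ℝ) × MomSpace =>
      ((-(I * ((q.2 0 : ℝ) : ℂ))) ^ n₀ * (-(I * ((q.2 1 : ℝ) : ℂ))) ^ n₁ * (-(I * ((q.2 2 : ℝ) : ℂ))) ^ n₂) *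
      (((gnShell 4 e₀ 0 (Real.sqrt (q.2 0 ^ 2 + rescaledEps ε u μ ((q.1.1, q.2 1, q.2 2), q.1.2) ^ 2)) *
            truncOne (2 * r) (Real.cos (3 * π / 4)) (Real.cos (7 * π / 8)) (uFun u (q.1.1, q.2 1, q.2 2) q.1.2) *
            sectorUnitWeight (rescaledAng u r ((q.1.1, q.2 1, q.2 2), q.1.2) / π) *
            χ (chartPt u (q.1.1, q.2 1, q.2 2) q.1.2) : ℝ) : ℂ) *
        (conj (rDenom ε u μ (q.1.1, q.2 1, q.2 2) (q.2 0) q.1.2) *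
          (sectorInvCutoff ((e₀ / 16) ^ 2) (Complex.normSq (rDenom ε u μ (q.1.1, q.2 1, q.2 2) (q.2 0) q.1.2)) : ℂ))) := by
    funext q; rfl
  rw [key]
  exact hfin

/-- `cos(7π/8) < cos(3π/4)` (re-exported from the tree for readability). [cite: BenfattoGiulianiMastropietro2003, §7.2 p.27 (L28–52)] -/
private theorem cos78_lt_cos34 : Real.cos (7 * π / 8) < Real.cos (3 * π / 4) := cos_seven_lt_cos_three

/-! ### The central identity -/

/-- `(2^{-n})² = 4^{-n}`. [cite: BenfattoGiulianiMastropietro2003, §2.3 p.7 (L131–133)] -/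
private theorem two_zpow_neg_sq (n : ℕ) : ((2 : ℝ) ^ (-(n : ℤ))) ^ 2 = (4 : ℝ) ^ (-(n : ℤ)) := by
  rw [← zpow_natCast, ← zpow_mul, show (4 : ℝ) = 2 ^ (2 : ℤ) by norm_num, ← zpow_mul]; congr 1; ring

/-- **The central identity.**  Let `χ` be a shell bump as in part 1 (`χ = 1` on `ℬ`; `χ(k⃗) ≠ 0 ⟹ ‖k⃗‖ ≥ 2r`;
`χ(k⃗) ≠ 0, k⃗ ∉ ℬ ⟹ |ε(k⃗) − μ| > e₀`).  Then for every scale `h = −n ≤ 0`, sector `σ` and `t = (t₀,a,b)`: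
`S_α(4^{-n}t₀, p⃗_F(θ_{h,σ}) + 4^{-n}a n⃗ + 2^{-n}b τ⃗) = 4ⁿ 4^{-nn₀} 4^{-nn₁} 2^{-nn₂} · Ψ_α(θ_{h,σ},a,b; t₀; 2^{-n})`.
Case analysis as in the tree's `rescaledSectorSymbol_eq_masterSymbol`: off the shell profile both sides vanish; on
it `conj(D̃)η = D̃⁻¹` and `|ε − μ| < e₀γ^h ≤ e₀`, so `k⃗ ∈ ℬ` exactly when `χ(k⃗) ≠ 0`, where `𝟙_ℬ = χ = 1`; there
`k⃗ ≠ 0`, the angular cutoff is `W(Θ/w_n) = W(Ã/π)` through the relative angle `Θ = arg u = 2^{-n}Ã`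
(`sectorWeightCirc_polarAngle_eq`, `truncArg = arg` for `|Θ| ≤ 7π/8`, `ψ = 1` for `|Θ| ≤ 3π/4`, and both angular
factors vanish for `|Θ| > 3π/4`). [cite: BenfattoGiulianiMastropietro2003, §2.3 (3.20)–(3.21a) p.8 (L10–41) and §7.2 p.27 (L28–52)] -/
theorem DispersionHyp.rescaledWSymbol_eq_master (hD : DispersionHyp ε μ e₀ u) {r : ℝ} (hr : 0 < r)
    {χ : (Fin 2 → ℝ) → ℝ} (hχ1 : ∀ k ∈ shell u e₀, χ k = 1) (hχr : ∀ k, χ k ≠ 0 → 2 * r ≤ ‖momToComplex k‖)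
    (hχε : ∀ k, χ k ≠ 0 → k ∉ shell u e₀ → e₀ < |ε k - μ|) (n σ n₀ n₁ n₂ : ℕ) (t : MomSpace) :
    rescaledWSymbol ε μ e₀ u n σ n₀ n₁ n₂ t =
      ((scaleFactor n n₀ n₁ n₂ : ℝ) : ℂ) *
        master ε u μ e₀ r χ n₀ n₁ n₂ (sectorCenter n σ, t 1, t 2) (t 0) ((2 : ℝ) ^ (-(n : ℤ))) := by
  have he := hD.e₀_pos
  -- notation
  set θ₀ : ℝ := sectorCenter n σ with hθ₀
  set s : ℝ := (2 : ℝ) ^ (-(n : ℤ)) with hs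
  set x : ℝ × ℝ × ℝ := (θ₀, t 1, t 2) with hx
  have hspos : 0 < s := zpow_pos (by norm_num) _
  have hs1 : s ≤ 1 := zpow_le_one_of_nonpos₀ (by norm_num) (by simp)
  have hs2 : s ^ 2 = (4 : ℝ) ^ (-(n : ℤ)) := two_zpow_neg_sq n
  have h4pos : 0 < (4 : ℝ) ^ (-(n : ℤ)) := zpow_pos (by norm_num) _
  have h44 : (4 : ℝ) ^ n * (4 : ℝ) ^ (-(n : ℤ)) = 1 := by rw [zpow_neg, zpow_natCast, mul_inv_cancel₀ (by positivity)]
  have hw : sectorWidth n = π * s := by rw [sectorWidth, hs, zpow_neg, zpow_natCast, div_eq_mul_inv]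
  set k : Fin 2 → ℝ := chartPt u x s with hk
  set E : ℝ := rescaledEps ε u μ (x, s) with hE
  set Dt : ℂ := rDenom ε u μ x (t 0) s with hDt
  have hEeq : ε k - μ = s ^ 2 * E := hD.epsFun_eq_sq_mul_rescaledEps x s
  -- the frame coordinates and the denominator in chart coordinates
  have hk1 : frameCoord₁ u θ₀ k = s ^ 2 * t 1 := hD.frameCoord₁_chartPt θ₀ (t 1) (t 2) s
  have hk2 : frameCoord₂ u θ₀ k = s * t 2 := hD.frameCoord₂_chartPt θ₀ (t 1) (t 2) s
  have hx1 : x.2.1 = t 1 := rfl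
  have hx2 : x.2.2 = t 2 := rfl
  have hD' : (-(I * (((4 : ℝ) ^ (-(n : ℤ)) * t 0 : ℝ) : ℂ)) + ((ε k - μ : ℝ) : ℂ)) = (((4 : ℝ) ^ (-(n : ℤ)) : ℝ) : ℂ) * Dt := by
    rw [hDt, rDenom, hEeq, hs2]; push_cast; ring
  have hρ : (4 : ℝ) ^ n * Real.sqrt ((((4 : ℝ) ^ (-(n : ℤ))) * t 0) ^ 2 + (ε k - μ) ^ 2) = Real.sqrt (t 0 ^ 2 + E ^ 2) := by
    rw [hEeq, hs2, show (((4 : ℝ) ^ (-(n : ℤ))) * t 0) ^ 2 + ((4 : ℝ) ^ (-(n : ℤ)) * E) ^ 2 =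
      ((4 : ℝ) ^ (-(n : ℤ))) ^ 2 * (t 0 ^ 2 + E ^ 2) by ring, Real.sqrt_mul (sq_nonneg _), Real.sqrt_sq h4pos.le,
      ← mul_assoc, h44, one_mul]
  have hshell : scaleCutoff ε μ e₀ n (((4 : ℝ) ^ (-(n : ℤ))) * t 0, k) = gnShell 4 e₀ 0 (Real.sqrt (t 0 ^ 2 + E ^ 2)) := by
    rw [scaleCutoff, gnShell_neg_natCast, hρ]
  -- the monomial weights
  have hmono : (-(I * ((((4 : ℝ) ^ (-(n : ℤ))) * t 0 : ℝ) : ℂ))) ^ n₀ * (-(I * ((frameCoord₁ u θ₀ k : ℝ) : ℂ))) ^ n₁ *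
      (-(I * ((frameCoord₂ u θ₀ k : ℝ) : ℂ))) ^ n₂ =
      ((((4 : ℝ) ^ (-(n : ℤ))) ^ n₀ * ((4 : ℝ) ^ (-(n : ℤ))) ^ n₁ * ((2 : ℝ) ^ (-(n : ℤ))) ^ n₂ : ℝ) : ℂ) *
        ((-(I * ((t 0 : ℝ) : ℂ))) ^ n₀ * (-(I * ((t 1 : ℝ) : ℂ))) ^ n₁ * (-(I * ((t 2 : ℝ) : ℂ))) ^ n₂) := by
    rw [hk1, hk2, hs2, ← hs]
    push_cast
    ring
  -- unfold both sides
  rw [rescaledWSymbol]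
  simp only
  rw [wSymbol, ← hθ₀, ← hx, ← hk, hmono, hD', sectorCutoff, hshell, master, scaleFactor]
  simp only [← hE, ← hDt, ← hk]
  -- Case 1: off the shell profile
  by_cases hG : gnShell 4 e₀ 0 (Real.sqrt (t 0 ^ 2 + E ^ 2)) = 0
  · rw [hG]; simp
  -- on the profile: `|D̃| ∈ (e₀/16, e₀)`, `conj(D̃) η = D̃⁻¹`, and `|ε(k) − μ| < e₀`
  have hmem := mem_Ioo_of_gnShell_zero_ne_zero he hG
  have hnSq : Complex.normSq Dt = t 0 ^ 2 + E ^ 2 := by rw [hDt, normSq_rDenom]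
  have hq₀ : 0 < (e₀ / 16) ^ 2 := by positivity
  have hnSq_ge : (e₀ / 16) ^ 2 / 2 ≤ Complex.normSq Dt := by
    rw [hnSq]
    have h1 : (e₀ / 16) ^ 2 < Real.sqrt (t 0 ^ 2 + E ^ 2) ^ 2 := by
      have := hmem.1
      have h0 : 0 ≤ e₀ / 16 := by positivity
      nlinarith [Real.sqrt_nonneg (t 0 ^ 2 + E ^ 2)]
    rw [Real.sq_sqrt (by positivity)] at h1
    linarith
  have hDt0 : Dt ≠ 0 := by
    intro h0; rw [h0, map_zero] at hnSq_ge; linarith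
  have hinv : conj Dt * (sectorInvCutoff ((e₀ / 16) ^ 2) (Complex.normSq Dt) : ℂ) = Dt⁻¹ := by
    rw [sectorInvCutoff_eq_inv hq₀ hnSq_ge, Complex.inv_def]
  rw [hinv]
  have hεk : |ε k - μ| < e₀ := by
    have hE' : E ^ 2 < e₀ ^ 2 := by
      have h2 := hmem.2
      have h3 : Real.sqrt (t 0 ^ 2 + E ^ 2) ^ 2 < e₀ ^ 2 := by
        nlinarith [Real.sqrt_nonneg (t 0 ^ 2 + E ^ 2)]
      rw [Real.sq_sqrt (by positivity)] at h3
      nlinarith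
    have hEabs : |E| < e₀ := abs_lt_of_sq_lt_sq' hE' he.le |>.2 |> fun h => abs_lt.2 ⟨(abs_lt_of_sq_lt_sq' hE' he.le).1, h⟩
    rw [hEeq, abs_mul, abs_of_nonneg (sq_nonneg s)]
    calc s ^ 2 * |E| ≤ 1 * |E| := mul_le_mul_of_nonneg_right (by nlinarith) (abs_nonneg _)
      _ < e₀ := by rw [one_mul]; exact hEabs
  -- Case 2: `k ∉ ℬ` — then both the indicator and `χ` vanish
  by_cases hkB : k ∈ shell u e₀
  swap
  · have hind : (shell u e₀).indicator (fun _ => (1 : ℝ)) k = 0 := Set.indicator_of_notMem hkB _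
    have hχ0 : χ k = 0 := by
      by_contra hne
      exact absurd (hχε k hne hkB) (not_lt.2 hεk.le)
    rw [hind, hχ0]; simp
  -- Case 3: `k ∈ ℬ`: indicator `= χ = 1`, `‖k‖ ≥ 2r`, `k ≠ 0`
  have hind : (shell u e₀).indicator (fun _ => (1 : ℝ)) k = 1 := Set.indicator_of_mem hkB _
  have hχk : χ k = 1 := hχ1 k hkB
  rw [hind, hχk]
  have hnk : 2 * r ≤ ‖momToComplex k‖ := hχr k (by rw [hχk]; exact one_ne_zero)
  have hk0 : k ≠ 0 := by
    intro h0
    rw [h0, (momToComplex_eq_zero_iff 0).2 rfl, norm_zero] at hnk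
    linarith
  -- the angular cutoff through the relative angle `arg u`
  set w : ℂ := uFun u x s with hwdef
  have hw0 : w ≠ 0 := by
    rw [hwdef, ← norm_pos_iff, norm_uFun]; linarith
  have hζ : sectorWeightCirc n σ (polarAngle k) = sectorUnitWeight (arg w / sectorWidth n) := by
    rw [hwdef, arg_uFun]
    have := sectorWeightCirc_polarAngle_eq n (σ : ℤ) hk0
    rw [Int.cast_natCast] at this
    exact this
  have hnw : 2 * r ≤ ‖w‖ := by rw [hwdef, norm_uFun]; exact hnk
  have hrw : r ≤ ‖w‖ := by linarith
  have hÃ : rescaledAng u r (x, s) / π = truncArg r (Real.cos (7 * π / 8)) (Real.cos (15 * π / 16)) w / sectorWidth n := by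
    have h1 := hD.angFun_eq_mul_rescaledAng hr x s
    rw [angFun] at h1
    simp only at h1
    rw [← hwdef] at h1
    rw [hw, h1]
    field_simp
  rw [hζ, hÃ]
  have h44c : (((4 : ℝ) ^ n : ℝ) : ℂ) * (((4 : ℝ) ^ (-(n : ℤ)) : ℝ) : ℂ) = 1 := by exact_mod_cast h44
  -- Case 3a/3b/3c on the relative angle
  by_cases harg : |arg w| ≤ 7 * π / 8
  · have htr : truncArg r (Real.cos (7 * π / 8)) (Real.cos (15 * π / 16)) w = arg w :=
      truncArg_eq_arg_of_abs_arg_le hr cos_fifteen_lt_cos_seven (by linarith [pi_pos]) le_rfl hrw harg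
    rw [htr]
    by_cases harg2 : |arg w| ≤ 3 * π / 4
    · -- the generic point: `ψ(u) = 1`
      have hone : truncOne (2 * r) (Real.cos (3 * π / 4)) (Real.cos (7 * π / 8)) w = 1 :=
        truncOne_eq_one_of_abs_arg_le (by positivity) cos78_lt_cos34 (by linarith [pi_pos]) le_rfl hnw harg2
      rw [hone, hx1, hx2]
      simp only [one_mul, mul_one]
      push_cast at h44c ⊢
      rw [div_eq_mul_inv, mul_inv, ← eq_inv_of_mul_eq_one_left h44c]
      ring
    · -- `3π/4 < |arg u| ≤ 7π/8`: the angular profile vanishes on both sides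
      push Not at harg2
      have hW : sectorUnitWeight (arg w / sectorWidth n) = 0 := by
        apply sectorUnitWeight_eq_zero
        rw [abs_div, abs_of_pos (sectorWidth_pos n), le_div_iff₀ (sectorWidth_pos n), hw]
        have hπs : π * s ≤ π := mul_le_of_le_one_right pi_pos.le hs1
        linarith
      rw [hW]; simp
  · -- `|arg u| > 7π/8`: `ψ(u) = 0` and the angular profile vanishes
    push Not at harg
    have hψ : truncOne (2 * r) (Real.cos (3 * π / 4)) (Real.cos (7 * π / 8)) w = 0 :=
      truncOne_eq_zero_of_le_abs_arg cos78_lt_cos34 (by positivity) le_rfl hw0 harg.le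
    have hW : sectorUnitWeight (arg w / sectorWidth n) = 0 := by
      apply sectorUnitWeight_eq_zero
      rw [abs_div, abs_of_pos (sectorWidth_pos n), le_div_iff₀ (sectorWidth_pos n), hw]
      have hπs : π * s ≤ π := mul_le_of_le_one_right pi_pos.le hs1
      linarith [pi_pos]
    rw [hψ, hW]; simp

/-- The identity as an equality of functions of `t`. [cite: BenfattoGiulianiMastropietro2003, §7.2 p.27 (L28–52)] -/
theorem DispersionHyp.rescaledWSymbol_eq_smul_masterL (hD : DispersionHyp ε μ e₀ u) {r : ℝ} (hr : 0 < r)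
    {χ : (Fin 2 → ℝ) → ℝ} (hχ1 : ∀ k ∈ shell u e₀, χ k = 1) (hχr : ∀ k, χ k ≠ 0 → 2 * r ≤ ‖momToComplex k‖)
    (hχε : ∀ k, χ k ≠ 0 → k ∉ shell u e₀ → e₀ < |ε k - μ|) (n σ n₀ n₁ n₂ : ℕ) :
    rescaledWSymbol ε μ e₀ u n σ n₀ n₁ n₂ = fun t =>
      ((scaleFactor n n₀ n₁ n₂ : ℝ) : ℂ) • masterL ε u μ e₀ r χ n₀ n₁ n₂ ((sectorCenter n σ, (2 : ℝ) ^ (-(n : ℤ))), t) := by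
  funext t
  rw [hD.rescaledWSymbol_eq_master hr hχ1 hχr hχε n σ n₀ n₁ n₂ t, smul_eq_mul]
  rfl

/-! ### The support box (F3b's Lemma 7.3) -/

/-- **The support of the weighted symbol**: `S_α(k) ≠ 0` implies `k⃗ ∈ S_{h,σ}` (the s-sector (3.44a)) and
`|k₀| < e₀γ^h`. [cite: BenfattoGiulianiMastropietro2003, §2.3 (3.20a) p.8 (L16–19) and §2.6 (3.44a) p.13 (L101–106)] -/
theorem DispersionHyp.mem_sSector_of_wSymbol_ne_zero (hD : DispersionHyp ε μ e₀ u) {n σ n₀ n₁ n₂ : ℕ}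
    {p : ℝ × (Fin 2 → ℝ)} (hp : wSymbol ε μ e₀ u n σ n₀ n₁ n₂ p ≠ 0) :
    p.2 ∈ sSector u e₀ n σ ∧ |p.1| < e₀ * (4 : ℝ) ^ (-(n : ℤ)) := by
  have he := hD.e₀_pos
  rw [wSymbol] at hp
  have hq := right_ne_zero_of_mul hp
  have hnum : ((sectorCutoff ε μ e₀ u n σ p : ℝ) : ℂ) ≠ 0 := by
    intro h0; apply hq; rw [h0, zero_div]
  have hsc : sectorCutoff ε μ e₀ u n σ p ≠ 0 := by exact_mod_cast hnum
  rw [sectorCutoff] at hsc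
  have hind : (shell u e₀).indicator (fun _ => (1 : ℝ)) p.2 ≠ 0 := left_ne_zero_of_mul (left_ne_zero_of_mul hsc)
  have hscale : scaleCutoff ε μ e₀ n p ≠ 0 := right_ne_zero_of_mul (left_ne_zero_of_mul hsc)
  have hζ : sectorWeightCirc n σ (polarAngle p.2) ≠ 0 := right_ne_zero_of_mul hsc
  have hkB : p.2 ∈ shell u e₀ := by
    by_contra h; exact hind (Set.indicator_of_notMem h _)
  have hIoo := mem_Ioo_of_scaleCutoff_ne_zero ε μ he hscale
  -- `|k₀|, |ε − μ| < e₀ 4^{-n}`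
  have hlt : Real.sqrt (p.1 ^ 2 + (ε p.2 - μ) ^ 2) < e₀ * (4 : ℝ) ^ (-(n : ℤ)) := hIoo.2
  have hp1 : |p.1| < e₀ * (4 : ℝ) ^ (-(n : ℤ)) := by
    refine lt_of_le_of_lt ?_ hlt
    rw [← Real.sqrt_sq_eq_abs]
    exact Real.sqrt_le_sqrt (by nlinarith)
  have hpe : |ε p.2 - μ| < e₀ * (4 : ℝ) ^ (-(n : ℤ)) := by
    refine lt_of_le_of_lt ?_ hlt
    rw [← Real.sqrt_sq_eq_abs]
    exact Real.sqrt_le_sqrt (by nlinarith)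
  refine ⟨?_, hp1⟩
  obtain ⟨θ, e, heB, hpeq⟩ := hkB
  have hεe : ε p.2 - μ = e := by rw [hpeq, hD.level θ e heB]; ring
  refine ⟨θ, e, ?_, ?_, hpeq⟩
  · rw [← hεe, mul_comm]; exact hpe.le
  · -- the angular cutoff at `polarAngle (levelPoint u θ e) = θ + 2πm`
    obtain ⟨m, hm⟩ := polarAngle_smul_dir (hD.radius_pos θ heB) θ
    rw [hpeq, levelPoint, hm, show θ + 2 * π * m = θ + m * (2 * π) by ring] at hζ
    rwa [(periodic_sectorWeightCirc n σ).int_mul m θ] at hζ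

/-- **The support box, uniform in the scale** (BGM's `|k'₁| ≤ Cγ^h`, `|k'₂| ≤ Cγ^{h/2}` after (3.21a), proved in
F3b as Lemma 7.3): there is `c > 0` with `rescaledWSymbol … t ≠ 0 ⟹ |t₀| ≤ e₀, |a| ≤ c, |b| ≤ c` for all `h ≤ 0`
and `σ ∈ O_h`. [cite: BenfattoGiulianiMastropietro2003, §2.3 (3.21a) p.8 (L36–41) and §7.1 Lemma 7.3 (A1.13) p.26 (L114–123)] -/
theorem DispersionHyp.exists_box_rescaledWSymbol (hD : DispersionHyp ε μ e₀ u) :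
    ∃ c : ℝ, 0 < c ∧ ∀ (n σ n₀ n₁ n₂ : ℕ), σ < sectorCount n → ∀ t : MomSpace,
      rescaledWSymbol ε μ e₀ u n σ n₀ n₁ n₂ t ≠ 0 → |t 0| ≤ e₀ ∧ |t 1| ≤ c ∧ |t 2| ≤ c := by
  obtain ⟨c, hc, H73⟩ := lemma73_sectorBox_holds ε μ e₀ u hD
  have he := hD.e₀_pos
  refine ⟨c, hc, fun n σ n₀ n₁ n₂ hω t ht => ?_⟩
  set s : ℝ := (2 : ℝ) ^ (-(n : ℤ)) with hs
  have hspos : 0 < s := zpow_pos (by norm_num) _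
  have hs2 : s ^ 2 = (4 : ℝ) ^ (-(n : ℤ)) := two_zpow_neg_sq n
  have h4pos : 0 < (4 : ℝ) ^ (-(n : ℤ)) := zpow_pos (by norm_num) _
  have h4le : (4 : ℝ) ^ (-(n : ℤ)) ≤ 1 := zpow_le_one_of_nonpos₀ (by norm_num) (by simp)
  rw [rescaledWSymbol] at ht
  obtain ⟨hsec, hp1⟩ := hD.mem_sSector_of_wSymbol_ne_zero ht
  simp only at hsec hp1
  obtain ⟨k₁, k₂, hkeq, hk₁, hk₂, -⟩ := H73 n σ hω _ hsec
  have hfc := hD.frameCoord_of_eq (sectorCenter n σ) k₁ k₂ hkeq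
  rw [hD.frameCoord₁_chartPt, hD.frameCoord₂_chartPt, ← hs] at hfc
  obtain ⟨h1, h2⟩ := hfc
  refine ⟨?_, ?_, ?_⟩
  · rw [abs_mul, abs_of_pos h4pos] at hp1
    nlinarith [abs_nonneg (t 0)]
  · have : |t 1| * (4 : ℝ) ^ (-(n : ℤ)) ≤ c * (4 : ℝ) ^ (-(n : ℤ)) :=
      calc |t 1| * (4 : ℝ) ^ (-(n : ℤ)) = |s ^ 2 * t 1| := by
            rw [abs_mul, abs_of_pos (by positivity : (0 : ℝ) < s ^ 2), hs2, mul_comm]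
        _ = |k₁| := by rw [h1]
        _ ≤ c * (4 : ℝ) ^ (-(n : ℤ)) := hk₁
    exact le_of_mul_le_mul_right this h4pos
  · have : |t 2| * s ≤ c * s :=
      calc |t 2| * s = |s * t 2| := by rw [abs_mul, abs_of_pos hspos, mul_comm]
        _ = |k₂| := by rw [h2]
        _ ≤ c * s := by rw [hs]; exact hk₂
    exact le_of_mul_le_mul_right this hspos

/-! ### `h`-uniform derivative bounds by compactness -/

/-- `θ_{h,σ} ∈ [0, 2π]` for `σ ∈ O_h`. [cite: BenfattoGiulianiMastropietro2003, §2.3 (3.14a) p.7 (L131–137)] -/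
theorem sectorCenter_mem_Icc {n σ : ℕ} (hω : σ < sectorCount n) : sectorCenter n σ ∈ Icc (0 : ℝ) (2 * π) := by
  have hw := sectorWidth_pos n
  have hN := sectorCount_mul_sectorWidth n
  have hω' : (σ : ℝ) + 1 ≤ sectorCount n := by exact_mod_cast hω
  refine ⟨by unfold sectorCenter; positivity, ?_⟩
  calc sectorCenter n σ = ((σ : ℝ) + 1 / 2) * sectorWidth n := rfl
    _ ≤ (sectorCount n : ℝ) * sectorWidth n := mul_le_mul_of_nonneg_right (by linarith) hw.le
    _ = 2 * π := hN

/-- **`h`-uniform derivative bounds of the rescaled weighted symbols** (the content of «`C_{N,m}` does not depend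
on `h, σ`» in Lemma 2.1): given a shell bump `χ` as in part 1, for every order `m` there is `B ≥ 0` with
`‖D^m(rescaledWSymbol … n σ n₀ n₁ n₂)(t)‖ ≤ scaleFactor n n₀ n₁ n₂ · B` for all `n`, all `σ < 2^{n+1}`, all `t`.
[cite: BenfattoGiulianiMastropietro2003, §2.3 Lemma 2.1 (3.22) p.8 (L57–63) and §7.2 p.27 (L28–52)] -/
theorem DispersionHyp.exists_norm_iteratedFDeriv_rescaledWSymbol_le (hD : DispersionHyp ε μ e₀ u) {r : ℝ}
    (hr : 0 < r) {χ : (Fin 2 → ℝ) → ℝ} (hχs : ContDiff ℝ ∞ χ) (hχ1 : ∀ k ∈ shell u e₀, χ k = 1)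
    (hχr : ∀ k, χ k ≠ 0 → 2 * r ≤ ‖momToComplex k‖) (hχε : ∀ k, χ k ≠ 0 → k ∉ shell u e₀ → e₀ < |ε k - μ|)
    (n₀ n₁ n₂ m : ℕ) :
    ∃ B : ℝ, 0 ≤ B ∧ ∀ (n σ : ℕ), σ < sectorCount n → ∀ t : MomSpace,
      ‖iteratedFDeriv ℝ m (rescaledWSymbol ε μ e₀ u n σ n₀ n₁ n₂) t‖ ≤ scaleFactor n n₀ n₁ n₂ * B := by
  obtain ⟨c, hc, hbox⟩ := hD.exists_box_rescaledWSymbol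
  -- the compact parameter × box set and a bound of the full derivative on it
  set P : Set (ℝ × ℝ) := Icc 0 (2 * π) ×ˢ Icc 0 1 with hP
  set T : Set MomSpace := {t | |t 0| ≤ e₀ ∧ |t 1| ≤ c ∧ |t 2| ≤ c} with hT
  have hK : IsCompact (P ×ˢ T) := (isCompact_Icc.prod isCompact_Icc).prod (isCompact_momBox _ _ _)
  have hF := hD.contDiff_masterL hr hχs n₀ n₁ n₂
  have hcont : ContinuousOn (fun q : (ℝ × ℝ) × MomSpace => iteratedFDeriv ℝ m (masterL ε u μ e₀ r χ n₀ n₁ n₂) q) (P ×ˢ T) :=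
    (hF.continuous_iteratedFDeriv (by exact_mod_cast le_top)).continuousOn
  obtain ⟨B, hB⟩ := hK.exists_bound_of_continuousOn hcont
  refine ⟨max B 0, le_max_right _ _, fun n σ hω t => ?_⟩
  set θ₀ : ℝ := sectorCenter n σ with hθ₀
  set s : ℝ := (2 : ℝ) ^ (-(n : ℤ)) with hs
  have hSF := scaleFactor_pos n n₀ n₁ n₂
  -- the parameters lie in `P`
  have hp : ((θ₀, s) : ℝ × ℝ) ∈ P :=
    ⟨sectorCenter_mem_Icc hω, ⟨(zpow_pos (by norm_num) _).le, zpow_le_one_of_nonpos₀ (by norm_num) (by simp)⟩⟩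
  have heq := hD.rescaledWSymbol_eq_smul_masterL hr hχ1 hχr hχε n σ n₀ n₁ n₂
  have hslice : ContDiff ℝ ∞ fun t : MomSpace => masterL ε u μ e₀ r χ n₀ n₁ n₂ ((θ₀, s), t) :=
    hF.comp (contDiff_const.prodMk contDiff_id)
  have hder : iteratedFDeriv ℝ m (rescaledWSymbol ε μ e₀ u n σ n₀ n₁ n₂) t =
      ((scaleFactor n n₀ n₁ n₂ : ℝ) : ℂ) • iteratedFDeriv ℝ m (fun t : MomSpace => masterL ε u μ e₀ r χ n₀ n₁ n₂ ((θ₀, s), t)) t := by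
    rw [heq]
    exact iteratedFDeriv_const_smul_apply' ((hslice.of_le (by exact_mod_cast le_top)).contDiffAt)
  by_cases ht : t ∈ T
  · -- on the box: the compactness bound
    rw [hder, norm_smul, Complex.norm_real, Real.norm_eq_abs, abs_of_pos hSF]
    refine mul_le_mul_of_nonneg_left ?_ hSF.le
    exact ((norm_iteratedFDeriv_slice_le hF (θ₀, s) m t).trans (hB _ (mk_mem_prod hp ht))).trans (le_max_left _ _)
  · -- off the box: the symbol vanishes identically near `t`
    have hsupp : tsupport (rescaledWSymbol ε μ e₀ u n σ n₀ n₁ n₂) ⊆ T := by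
      refine closure_minimal (fun v hv => ?_) (isCompact_momBox _ _ _).isClosed
      exact hbox n σ n₀ n₁ n₂ hω v hv
    have h0 : iteratedFDeriv ℝ m (rescaledWSymbol ε μ e₀ u n σ n₀ n₁ n₂) t = 0 := by
      by_contra hne
      exact ht (hsupp (support_iteratedFDeriv_subset m (Function.mem_support.2 hne)))
    rw [h0, norm_zero]
    positivity

/-- **Smoothness and compact support of the rescaled weighted symbol** (so that the Fourier-decay lemma of
`Analysis/Fourier/FourierDecayFromDerivBounds` applies): for every `h ≤ 0`, `σ ∈ O_h` it is `C^∞` with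
`tsupport` inside the fixed box. [cite: BenfattoGiulianiMastropietro2003, §7.2 p.27 (L28–52)] -/
theorem DispersionHyp.contDiff_rescaledWSymbol (hD : DispersionHyp ε μ e₀ u) {r : ℝ} (hr : 0 < r)
    {χ : (Fin 2 → ℝ) → ℝ} (hχs : ContDiff ℝ ∞ χ) (hχ1 : ∀ k ∈ shell u e₀, χ k = 1)
    (hχr : ∀ k, χ k ≠ 0 → 2 * r ≤ ‖momToComplex k‖) (hχε : ∀ k, χ k ≠ 0 → k ∉ shell u e₀ → e₀ < |ε k - μ|)
    (n σ n₀ n₁ n₂ : ℕ) : ContDiff ℝ ∞ (rescaledWSymbol ε μ e₀ u n σ n₀ n₁ n₂) := by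
  rw [hD.rescaledWSymbol_eq_smul_masterL hr hχ1 hχr hχε n σ n₀ n₁ n₂]
  exact ((hD.contDiff_masterL hr hχs n₀ n₁ n₂).comp (contDiff_const.prodMk contDiff_id)).const_smul _

end BGM2003

end Literature.MathematicalPhysics.QuantumLattice.FermiRG

end
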